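import Mathlib
import Literature.NumberTheory.Irrationality.Brown2016.DinnerParties
import Summits.KontsevichZagierPeriods.Zeta5Search.Families.CellularIntegral
import Summits.KontsevichZagierPeriods.Zeta5Search.Families.BasicConvergence
import Summits.KontsevichZagierPeriods.Zeta5Search.Families.FastConvergence
import Summits.KontsevichZagierPeriods.Zeta5Search.Families.ChordCrossings
import Summits.KontsevichZagierPeriods.Zeta5Search.Families.BasicConvergenceGeneral
import HarnessLib

/-!
# ζ(5) search — Families: printed seating plans — `Brown2016.IsConvergent n τ ↔ Convergent (ofSeating τ)`, and Brown's Lemma 3.6 for plans of ANY size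

HONEST FRAMING: systematic search; no irrationality claim unless certified.

Cell `pub-zeta5`, seat P2.  `Families/BasicConvergenceGeneral.lean` proves, for every bijective seating
`σ : ℤ/n → ℤ/n`, `BrownConvergent σ N N ↔ Convergent σ` (`N ≥ 0`).  The cell's configuration lists
(`Brown2016.reps5–8`, `Configurations.reps9`, `Cells.ConfigurationsTen.reps10`) are PRINTED PLANS `τ : List ℕ`
(the guests `1,…,n` in seating order) with Brown's list-level test `Brown2016.IsConvergent n τ`
[Brown2016, §1.5, §3.1] and the reading map `ofSeating τ : Fin n → Fin n` of `Families/CellularIntegral.lean`.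
This file links the two levels for seating plans (`Brown2016.IsSeating n τ`: `τ` is a rearrangement of `1,…,n`):
* `bijective_ofSeating` — `ofSeating τ` is a bijection;
* `windowInBlock_ofSeating_iff` — Brown's block test `isCyclicBlock n (window τ s k)` on a window of `k ≤ n`
  guests holds iff `ofSeating τ` seats the arc of positions `{s,…,s+k−1}` into an arc of places (the direction
  "(ii) ⇒ (i)" of the block test is a pigeonhole on the `k` distinct guests, `block_subset_window`);
* `convergent_ofSeating_iff` — **`Convergent (ofSeating τ) ↔ IsConvergent n τ`**;
* `brownConvergent_basic_of_isConvergent`, `isConvergent_of_brownConvergent_basic`,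
  `brownConvergent_basic_ofSeating_iff` — **Brown's Lemma 3.6 (combinatorial form) for printed plans of any
  number `n ≥ 3` of guests and every `N ≥ 0`: `BrownConvergent (ofSeating τ) N N ↔ IsConvergent n τ`** — by
  theorem, superseding the per-configuration kernel certificates `brownConvergent_basic_reps9/10` of
  `Families/BasicConvergence.lean` and applying unchanged to `N = 11, 12, …` (`𝒞₁₁ = 7028`, never enumerated).
[Brown2016, §1.5 "the basic cellular integral … converges if and only if `σ` is a convergent permutation";
Lemma 3.6; Lemma 3.8.]  The analytic half (integrability ⇔ `BrownConvergent`) is Brown's [§2.4] and is not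
asserted here.
-/
namespace Summit.KontsevichZagierPeriods.Zeta5Search.Families.Cellular

open Finset Literature.NumberTheory.Irrationality.Brown2016
open Summit.KontsevichZagierPeriods.Zeta5Search.Families.Configurations (isCyclicBlock_iff)

variable {ℓ : ℕ} {τ : List ℕ}

/-! ### Printed seating plans: length, range of values, distinctness -/

/-- A seating plan of `n` guests has length `n`. -/
theorem length_of_isSeating (hτ : IsSeating (ℓ + 3) τ) : τ.length = ℓ + 3 := by
  unfold IsSeating at hτ
  rw [hτ.length_eq, List.length_range']

/-- The guests of a seating plan are `1, …, n`. -/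
theorem mem_iff_of_isSeating (hτ : IsSeating (ℓ + 3) τ) {x : ℕ} : x ∈ τ ↔ 1 ≤ x ∧ x ≤ ℓ + 3 := by
  unfold IsSeating at hτ
  rw [hτ.mem_iff, List.mem_range'_1]
  omega

/-- A seating plan has no repeated guest. -/
theorem nodup_of_isSeating (hτ : IsSeating (ℓ + 3) τ) : τ.Nodup := by
  unfold IsSeating at hτ
  exact hτ.nodup_iff.2 List.nodup_range'

/-- The guest at position `m < n` is one of `1, …, n`. -/
theorem getD_mem_of_isSeating (hτ : IsSeating (ℓ + 3) τ) {m : ℕ} (hm : m < ℓ + 3) :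
    1 ≤ τ.getD m 0 ∧ τ.getD m 0 ≤ ℓ + 3 := by
  rw [← mem_iff_of_isSeating hτ, List.getD_eq_getElem _ _ (by rw [length_of_isSeating hτ]; exact hm)]
  exact List.getElem_mem _

/-- Distinct positions seat distinct guests. -/
theorem getD_injective_of_isSeating (hτ : IsSeating (ℓ + 3) τ) {m m' : ℕ} (hm : m < ℓ + 3) (hm' : m' < ℓ + 3)
    (h : τ.getD m 0 = τ.getD m' 0) : m = m' := by
  have hl := length_of_isSeating hτ
  rw [List.getD_eq_getElem _ _ (by rw [hl]; exact hm), List.getD_eq_getElem _ _ (by rw [hl]; exact hm')] at h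
  exact (nodup_of_isSeating hτ).getElem_inj_iff.1 h

/-! ### Guests as residues modulo `n` -/

section Residues

open Fin.NatCast Fin.CommRing

/-- Two guests `1 ≤ x, y ≤ n` with the same residue mod `n` are equal. -/
theorem eq_of_mod_eq {x y : ℕ} (hx : 1 ≤ x ∧ x ≤ ℓ + 3) (hy : 1 ≤ y ∧ y ≤ ℓ + 3)
    (h : x % (ℓ + 3) = y % (ℓ + 3)) : x = y := by
  rcases Nat.lt_or_ge x (ℓ + 3) with hx' | hx'
  · rcases Nat.lt_or_ge y (ℓ + 3) with hy' | hy'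
    · rwa [Nat.mod_eq_of_lt hx', Nat.mod_eq_of_lt hy'] at h
    · have : y = ℓ + 3 := by omega
      rw [this, Nat.mod_self, Nat.mod_eq_of_lt hx'] at h
      omega
  · rcases Nat.lt_or_ge y (ℓ + 3) with hy' | hy'
    · have : x = ℓ + 3 := by omega
      rw [this, Nat.mod_self, Nat.mod_eq_of_lt hy'] at h
      omega
    · omega

/-- Equality of residues `x ≡ a + j (mod n)` as an equation in `ℤ/n = Fin n`. -/
theorem natCast_eq_add_iff (x a j : ℕ) :
    (x : Fin (ℓ + 3)) = (a : Fin (ℓ + 3)) + (j : Fin (ℓ + 3)) ↔ x % (ℓ + 3) = (a + j) % (ℓ + 3) := by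
  rw [Fin.ext_iff, Fin.val_add, Fin.val_natCast, Fin.val_natCast, Fin.val_natCast, ← Nat.add_mod]

/-- Membership in an arc in additive form: `y ∈ {a, …, a+k−1}` iff `y = a + m` for some `m < k` (`k ≤ n`). -/
theorem mem_arc_iff_exists {a y : Fin (ℓ + 3)} {k : ℕ} (hk : k ≤ ℓ + 3) :
    y ∈ arc a k ↔ ∃ m : ℕ, m < k ∧ y = a + (m : Fin (ℓ + 3)) := by
  rw [mem_arc]
  constructor
  · intro h
    exact ⟨_, h, by rw [Fin.cast_val_eq_self, add_sub_cancel]⟩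
  · rintro ⟨m, hm, rfl⟩
    rw [add_sub_cancel_left, Fin.val_cast_of_lt (by omega)]
    exact hm

/-- The position `s + j` (`j < n`) has index `(s + j) mod n`. -/
theorem val_add_natCast (s : Fin (ℓ + 3)) (j : ℕ) :
    ((s + (j : Fin (ℓ + 3)) : Fin (ℓ + 3)) : ℕ) = ((s : ℕ) + j) % (ℓ + 3) := by
  rw [Fin.val_add, Fin.val_natCast, Nat.add_mod_mod]

/-- For a seating plan, `ofSeating τ i` is the residue of the guest number minus one: `τ[i] − 1 (mod n)`. -/
theorem ofSeating_eq_sub_one (hτ : IsSeating (ℓ + 3) τ) (i : Fin (ℓ + 3)) :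
    ofSeating (ℓ := ℓ) τ i = ((τ.getD i.val 0 : ℕ) : Fin (ℓ + 3)) - 1 := by
  have hl := length_of_isSeating hτ
  have hx := getD_mem_of_isSeating hτ i.isLt
  have hget : τ.getD i.val 1 = τ.getD i.val 0 := by
    rw [List.getD_eq_getElem _ _ (by rw [hl]; exact i.isLt), List.getD_eq_getElem _ _ (by rw [hl]; exact i.isLt)]
  rw [eq_sub_iff_add_eq]
  apply Fin.ext
  simp only [ofSeating, hget, Fin.val_add, Fin.val_one, Fin.val_natCast]
  rw [Nat.mod_eq_of_lt (show τ.getD i.val 0 - 1 < ℓ + 3 by omega),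
    show τ.getD i.val 0 - 1 + 1 = τ.getD i.val 0 by omega]

/-- The cyclic window as guest numbers: `(window τ s k)[j] = τ[(s + j) mod n]`. -/
theorem mem_window_iff (hτ : IsSeating (ℓ + 3) τ) (s k : ℕ) {x : ℕ} :
    x ∈ window τ s k ↔ ∃ j : ℕ, j < k ∧ x = τ.getD ((s + j) % (ℓ + 3)) 0 := by
  unfold window
  rw [length_of_isSeating hτ]
  simp only [List.mem_map, List.mem_range]
  constructor
  · rintro ⟨j, hj, rfl⟩
    exact ⟨j, hj, rfl⟩
  · rintro ⟨j, hj, rfl⟩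
    exact ⟨j, hj, rfl⟩

/-- Length of a window. -/
theorem length_window (σ : List ℕ) (s k : ℕ) : (window σ s k).length = k := by
  unfold window
  rw [List.length_map, List.length_range]

/-- The guests of the window `{s, …, s+k−1}` lie in the block `{a'+0, …, a'+(k−1)} (mod n)` — condition (ii) of
Brown's block test — iff the seating `ofSeating τ` maps the arc of positions `arc s k` into the arc `arc (a'−1) k`. -/
theorem window_subset_block_iff (hτ : IsSeating (ℓ + 3) τ) (s : Fin (ℓ + 3)) {k : ℕ} (hk : k ≤ ℓ + 3) (a' : ℕ) :
    (∀ x ∈ window τ s k, x % (ℓ + 3) ∈ (List.range (window τ s k).length).map fun j => (a' + j) % (ℓ + 3)) ↔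
      ∀ i : Fin (ℓ + 3), i ∈ arc s k → ofSeating (ℓ := ℓ) τ i ∈ arc ((a' : Fin (ℓ + 3)) - 1) k := by
  rw [length_window]
  simp only [List.mem_map, List.mem_range, mem_window_iff hτ]
  constructor
  · intro h i hi
    rw [mem_arc_iff_exists hk] at hi
    obtain ⟨j, hj, rfl⟩ := hi
    obtain ⟨m, hm, hmod⟩ := h _ ⟨j, hj, rfl⟩
    rw [mem_arc_iff_exists hk]
    refine ⟨m, hm, ?_⟩
    rw [ofSeating_eq_sub_one hτ, val_add_natCast, (natCast_eq_add_iff _ _ _).2 hmod.symm]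
    abel
  · intro h x ⟨j, hj, hx⟩
    subst hx
    have hi : s + (j : Fin (ℓ + 3)) ∈ arc s k := (mem_arc_iff_exists hk).2 ⟨j, hj, rfl⟩
    have := h _ hi
    rw [mem_arc_iff_exists hk] at this
    obtain ⟨m, hm, hm'⟩ := this
    rw [ofSeating_eq_sub_one hτ, val_add_natCast] at hm'
    refine ⟨m, hm, ?_⟩
    have : ((τ.getD (((s : ℕ) + j) % (ℓ + 3)) 0 : ℕ) : Fin (ℓ + 3)) = (a' : Fin (ℓ + 3)) + (m : Fin (ℓ + 3)) := by
      have := congrArg (· + (1 : Fin (ℓ + 3))) hm'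
      simp only [sub_add_cancel] at this
      rw [this]
      abel
    exact ((natCast_eq_add_iff _ _ _).1 this).symm

/-- **Pigeonhole**: if the `k ≤ n` guests of a window of a SEATING lie in a block of `k` consecutive residues, they
exhaust it (condition (ii) of Brown's block test implies condition (i)). -/
theorem block_subset_window (hτ : IsSeating (ℓ + 3) τ) (s : Fin (ℓ + 3)) {k : ℕ} (hk : k ≤ ℓ + 3) (a' : ℕ)
    (h : ∀ x ∈ window τ s k, x % (ℓ + 3) ∈ (List.range (window τ s k).length).map fun j => (a' + j) % (ℓ + 3)) :
    ∀ j < (window τ s k).length, (a' + j) % (ℓ + 3) ∈ (window τ s k).map (· % (ℓ + 3)) := by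
  rw [length_window] at h ⊢
  simp only [List.mem_map, List.mem_range, mem_window_iff hτ] at h ⊢
  -- the guest of position `s + j` as a residue, and its offset in the block
  set g : ℕ → Fin (ℓ + 3) := fun j => ((τ.getD (((s : ℕ) + j) % (ℓ + 3)) 0 : ℕ) : Fin (ℓ + 3)) with hg
  have hoff : ∀ j, j < k → ∃ m, m < k ∧ g j = (a' : Fin (ℓ + 3)) + (m : Fin (ℓ + 3)) := by
    intro j hj
    obtain ⟨m, hm, hmod⟩ := h _ ⟨j, hj, rfl⟩
    exact ⟨m, hm, (natCast_eq_add_iff _ _ _).2 hmod.symm⟩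
  -- `f j = offset of the guest at position s+j`; maps `range k → range k` injectively
  have hsurj := Finset.surj_on_of_inj_on_of_card_le (s := range k) (t := range k)
    (fun j _ => ((g j - (a' : Fin (ℓ + 3)) : Fin (ℓ + 3)) : ℕ)) ?_ ?_ le_rfl
  · intro m hm
    obtain ⟨j, hj, hjm⟩ := hsurj m (mem_range.2 hm)
    rw [mem_range] at hj
    refine ⟨τ.getD (((s : ℕ) + j) % (ℓ + 3)) 0, ⟨j, hj, rfl⟩, ?_⟩
    have hgj : g j = (a' : Fin (ℓ + 3)) + (m : Fin (ℓ + 3)) := by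
      have hm' : ((m : Fin (ℓ + 3)) : ℕ) = ((g j - (a' : Fin (ℓ + 3)) : Fin (ℓ + 3)) : ℕ) := by
        rw [Fin.val_cast_of_lt (by omega), hjm]
      have := Fin.ext hm'
      rw [this]
      abel
    exact (natCast_eq_add_iff _ _ _).1 hgj
  · intro j hj
    rw [mem_range] at hj
    obtain ⟨m, hm, hgm⟩ := hoff j hj
    rw [mem_range, hgm, add_sub_cancel_left, Fin.val_cast_of_lt (by omega)]
    exact hm
  · intro j₁ j₂ hj₁ hj₂ heq
    rw [mem_range] at hj₁ hj₂
    have h1 : g j₁ = g j₂ := by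
      have := Fin.ext heq
      simpa using this
    simp only [hg] at h1
    rw [Fin.ext_iff, Fin.val_natCast, Fin.val_natCast] at h1
    have h2 := eq_of_mod_eq (getD_mem_of_isSeating hτ (Nat.mod_lt _ (by omega)))
      (getD_mem_of_isSeating hτ (Nat.mod_lt _ (by omega))) h1
    have h3 := getD_injective_of_isSeating hτ (Nat.mod_lt _ (by omega)) (Nat.mod_lt _ (by omega)) h2
    have hs := s.isLt
    rcases Nat.lt_or_ge ((s : ℕ) + j₁) (ℓ + 3) with c1 | c1 <;>
      rcases Nat.lt_or_ge ((s : ℕ) + j₂) (ℓ + 3) with c2 | c2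
    · rw [Nat.mod_eq_of_lt c1, Nat.mod_eq_of_lt c2] at h3; omega
    · rw [Nat.mod_eq_of_lt c1, Nat.mod_eq_sub_mod c2, Nat.mod_eq_of_lt (by omega)] at h3; omega
    · rw [Nat.mod_eq_sub_mod c1, Nat.mod_eq_of_lt (by omega), Nat.mod_eq_of_lt c2] at h3; omega
    · rw [Nat.mod_eq_sub_mod c1, Nat.mod_eq_of_lt (by omega), Nat.mod_eq_sub_mod c2,
        Nat.mod_eq_of_lt (by omega)] at h3; omega

/-- **The two convergence conditions agree on the atoms**: for a seating plan `τ` of `n` guests and `k ≤ n`, the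
window of positions `{s,…,s+k−1}` is seated by `ofSeating τ` into a block of `k` consecutive places iff Brown's
block test `isCyclicBlock n (window τ s k)` holds. [Brown2016, §1.5, §3.1] -/
theorem windowInBlock_ofSeating_iff (hτ : IsSeating (ℓ + 3) τ) (s : Fin (ℓ + 3)) {k : ℕ} (hk : k ≤ ℓ + 3) :
    WindowInBlock (ofSeating (ℓ := ℓ) τ) s k ↔ isCyclicBlock (ℓ + 3) (window τ s k) = true := by
  rw [isCyclicBlock_iff]
  constructor
  · rintro ⟨a, ha⟩
    refine ⟨(((a + 1 : Fin (ℓ + 3))) : ℕ), Fin.isLt _, ?_, ?_⟩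
    · exact block_subset_window hτ s hk _ ((window_subset_block_iff hτ s hk _).2 (by simpa using ha))
    · exact (window_subset_block_iff hτ s hk _).2 (by simpa using ha)
  · rintro ⟨a', -, -, h2⟩
    exact ⟨_, (window_subset_block_iff hτ s hk a').1 h2⟩

end Residues

/-! ### Convergence of printed plans = convergence of the seating; bijectivity -/

/-- **`Convergent (ofSeating τ) ↔ Brown2016.IsConvergent n τ`** for seating plans `τ` of `n = ℓ + 3` guests:
the `Fin`-level condition of `Families/BasicConvergenceGeneral.lean` is exactly Brown's printed-list condition.
[Brown2016, §1.5, §3.1] -/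
theorem convergent_ofSeating_iff (hτ : IsSeating (ℓ + 3) τ) :
    Convergent (ofSeating (ℓ := ℓ) τ) ↔ IsConvergent (ℓ + 3) τ := by
  unfold Convergent IsConvergent isConvergent
  simp only [List.all_eq_true, List.mem_range, Bool.not_eq_true', Nat.add_sub_cancel]
  constructor
  · intro h k' hk' i hi
    have := h ⟨i, hi⟩ (k' + 2) (by omega) (by omega)
    rw [windowInBlock_ofSeating_iff hτ _ (by omega)] at this
    simpa using this
  · intro h s k hk hk2 hw
    rw [windowInBlock_ofSeating_iff hτ _ (by omega)] at hw
    have := h (k - 2) (by omega) s s.isLt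
    rw [show k - 2 + 2 = k by omega] at this
    rw [this] at hw
    exact Bool.false_ne_true hw

/-- A seating plan defines a BIJECTION `ofSeating τ : ℤ/n → ℤ/n` (positions → guests). -/
theorem bijective_ofSeating (hτ : IsSeating (ℓ + 3) τ) : Function.Bijective (ofSeating (ℓ := ℓ) τ) := by
  rw [← Finite.injective_iff_bijective]
  intro i j hij
  have hl := length_of_isSeating hτ
  have h := congrArg Fin.val hij
  have hi := getD_mem_of_isSeating hτ i.isLt
  have hj := getD_mem_of_isSeating hτ j.isLt
  have hgi : τ.getD i.val 1 = τ.getD i.val 0 := by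
    rw [List.getD_eq_getElem _ _ (by rw [hl]; exact i.isLt), List.getD_eq_getElem _ _ (by rw [hl]; exact i.isLt)]
  have hgj : τ.getD j.val 1 = τ.getD j.val 0 := by
    rw [List.getD_eq_getElem _ _ (by rw [hl]; exact j.isLt), List.getD_eq_getElem _ _ (by rw [hl]; exact j.isLt)]
  simp only [ofSeating, hgi, hgj] at h
  rw [Nat.mod_eq_of_lt (by omega), Nat.mod_eq_of_lt (by omega)] at h
  exact Fin.ext (getD_injective_of_isSeating hτ i.isLt j.isLt (by omega))

/-! ### Headline: Brown's Lemma 3.6 for printed plans of ANY size -/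

/-- **Every convergent seating plan, of any number `n ≥ 3` of guests, has Brown-convergent basic cellular
integrals for every exponent `N ≥ 0`** — by theorem, with no enumeration (supersedes the per-configuration
certificates `brownConvergent_basic_reps9/10`; applies verbatim to `N = 11, 12, …`). [Brown2016, Lemma 3.6] -/
theorem brownConvergent_basic_of_isConvergent (hτ : IsSeating (ℓ + 3) τ) (hc : IsConvergent (ℓ + 3) τ)
    {N : ℤ} (hN : 0 ≤ N) : BrownConvergent (ofSeating (ℓ := ℓ) τ) (fun _ => N) (fun _ => N) :=
  brownConvergent_basic_of_convergent (bijective_ofSeating hτ) ((convergent_ofSeating_iff hτ).2 hc) hN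

/-- **… and only they**: a seating plan whose basic integrand passes Brown's convergence test for some `N ≥ 0` is a
convergent plan. [Brown2016, Lemma 3.6] -/
theorem isConvergent_of_brownConvergent_basic (hτ : IsSeating (ℓ + 3) τ) {N : ℤ} (hN : 0 ≤ N)
    (h : BrownConvergent (ofSeating (ℓ := ℓ) τ) (fun _ => N) (fun _ => N)) : IsConvergent (ℓ + 3) τ :=
  (convergent_ofSeating_iff hτ).1 ((brownConvergent_basic_iff_convergent (bijective_ofSeating hτ) hN).1 h)

/-- **Brown's Lemma 3.6 (combinatorial form) for printed plans**: for a seating plan `τ` of `n ≥ 3` guests and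
`N ≥ 0`, `BrownConvergent (ofSeating τ) N N ↔ IsConvergent n τ`. [Brown2016, §1.5, Lemma 3.6] -/
theorem brownConvergent_basic_ofSeating_iff (hτ : IsSeating (ℓ + 3) τ) {N : ℤ} (hN : 0 ≤ N) :
    BrownConvergent (ofSeating (ℓ := ℓ) τ) (fun _ => N) (fun _ => N) ↔ IsConvergent (ℓ + 3) τ :=
  ⟨isConvergent_of_brownConvergent_basic hτ hN, fun hc => brownConvergent_basic_of_isConvergent hτ hc hN⟩

end Summit.KontsevichZagierPeriods.Zeta5Search.Families.Cellular
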